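/- Copyright: the b2b-balaban cell (near-miss cell 7), T⁴-continuum fan-out; row NE7b ROUND-2 swarm, seat
t4-ne7b-formalise-leaf-03 (gen 6) (road W-RP, offer «W7-opt (t5)» — journal INTENT l.18178; the node test of row W7's
witness shape, `t4/b2b-balaban-t4-ne7b-p1/LEAVES-NE7b.md` v3.59).  Released under the licence of the surrounding project. -/
import Summits.QuantumFields.BalabanUV.T4Continuum.Support.HistoryChessboardGibbs
import Summits.QuantumFields.BalabanUV.T4Continuum.Support.HistoryChessboardApexWitness

/-!
# Road W-RP, row W7: THE GIBBS-CUBE-TOWER WITNESS SHAPE IS INHABITED — on every datum with measurable averagings (t5)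

Summits-side support leaf of the T⁴-continuum cell (rung (B)+1 on a FINITE torus only; NOT infinite volume, NOT the
mass gap, NOT the Clay statement; NOT a proof of the spine estimate NE7b).  Row NE7b, road **W-RP** (R-OWNER-23-2 ∕
R-OWNER-23-8), offer «W7-opt (t5)»: the NON-VACUITY NODE TEST of the hypothesis shape
`HistoryChessboardGibbs.ChessboardGibbsWitness` (row W7, this lineage, p227659) — the one displayed datum of W7's ENDs
`forSmallCouplings_stringwise_of_gibbsWitness` ∕ `hybridNE7Under_of_gibbsWitness_fsc` ∕ `targets_of_gibbsWitness_fsc` ∕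
`continuumYM4Torus_of_gibbsWitness_fsc`.  It is the Gibbs-tower twin of row W6's node test `HistoryChessboardApexWitness`
(leaf-02 g10, p226019), whose dressed integrals `ZOf`, log-ratios `nuOf` and identities `ZOf_eq_exp_mul` ∕ `exp_nuOf_mul`
are used BY NAME.  [folklore] bookkeeping + a decided toy over TREE objects; ONE data definition (`gibbsWitnessOf`, a
structure VALUE like p226019's `witnessOf`); nothing printed is asserted, no `[cite:]` tag, no `Prop`-valued FACT minted
(c1), no constant (c2∕c6), no exit ∕ socket ∕ `HistoryConstants` file touched (c3).

THE QUESTION.  W6's witness has ABSTRACT carriers, states, partition functions and observables, and p226019 inhabits it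
on the one-point carrier `Unit` with Dirac states.  W7's witness FIXES all of these to the tree's real objects: run A at
cutoff `K` lives on `Tower (F.P K) G K` under the Gibbs tower law `gibbsTower D g₀ K` of the data's OWN averagings, the
partition function is `Zrun D K (g₀ K)`, the observable is `obsTower K os`, the reflections ∕ positive algebras are
`cubeRefl` ∕ `cubePos`; the weights are tied to them by `GibbsCubeSide.repr`.  Is the shape still inhabited, and where?

THE ANSWER (decided here): EXACTLY where W6's is, modulo the one named hypothesis `D.AvgMeasurable` (needed because the
weights are now integrals against a real tower law) — for EVERY datum `D : FiniteEpsData F G` with measurable averagings,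
every run `g₀` and every loop string whose product observable is identically `1` (every string over a subsingleton gauge
group, e.g. `SU(1)`; the EMPTY string over any regular group), the placeholder `stubData` included.

WHAT IS BUILT.
* §1 **`gibbsCubeSide_univ`** — for EVERY datum with `D.AvgMeasurable`, EVERY run, EVERY string and EVERY cutoff: W7's
  eleven-clause side `GibbsCubeSide` holds for ONE term whose event is the whole tower, NO pattern, empty bad class, rate
  `0`, with the weight `ZOf D g₀ os K t` — the clause `repr` being W-E1's E1 identity `integral_exp_mul_prodObs_dens_zero`
  (p226638) read on `Set.univ`.  (W7's own §5 sanity used the DEFINED weight; here the weight is the datum's dressed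
  integral and `repr` is a THEOREM.)
* §2 **`gibbsWitnessOf D hM hobs : ChessboardGibbsWitness D g₀ os Unit Unit 0`** under `hobs : prodObs ≡ 1` — sides from
  §1 at `K` and `K+1`, shells `0` (`shellWeightBound_zero`), the NE7 budget WITH EQUALITY (`Cc K t () := ν K := nuOf … K`,
  radii ∕ recent constants ∕ rates `0`; p226019's `exp_nuOf_mul`), `l₀ = vol = 1`, `K₀ = 0`, cubes of side `L^0`.
  `nonempty_gibbsWitness_of_prodObs`; `nonempty_gibbsWitness_nil` (EMPTY string: ANY datum with `hM`, ANY regular group,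
  ANY run); `nonempty_gibbsWitness_stubData_nil`.
* §3 over a SUBSINGLETON gauge group (every string): `nonempty_gibbsWitness`; W7's headline binder VERBATIM —
  **`forSmallCouplings_gibbsWitness`** (`ForSmallCouplings D (fun g₀ => ∀ os, ∃ ι Λ _ m₁, Nonempty (ChessboardGibbsWitness …))`)
  — for EVERY datum with `hM`; `…_SU1`.
* §4 HENCE W7's ENDs FIRE on the toy for (0.4)-block-averaged data with a measurable small-loop average (`hBA`, `hE` —
  which also supply `hM`): the per-witness END for the EMPTY string at every `SU(n)` (`stringHybridNE7_nil_fires`), and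
  at `SU(1)` the pin-free ENDs (stringwise ∕ apex input as `example`s — as facts they are p226019's — and the NEW
  **`targets_fire_SU1`**: the four prefixed T⁴ targets for (0.4)-block-averaged `SU(1)` data; W7's `…_of_gibbsWitness(_fsc)`
  APPLIED; the empty product ∕ every loop variable over the TRIVIAL group is `1`, so these are plumbing tests of the road,
  physically empty).  The (B)-antecedent headline `continuumYM4Torus_of_gibbsWitness_fsc` is exercised by no toy (as for
  W6 and the count road).

HONEST.  A node test of a hypothesis SHAPE: one term, no pattern, no bad term make every (EXT)∕(LOC)∕(R-sym)∕(U1)+(G2)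
clause and the NE7c∕NE7 fields trivial BY DESIGN; for a non-trivial string on a non-trivial group the two-run budget IS
NE7's content, available on no toy.  Discharges NOTHING of the nine spine estimates; NE7b NOT proved; spine 0∕9.  HONEST
DEPENDENCY (cell): continuum YM on T⁴ ⇐ BetaPertH ∧ nine spine estimates (0/9 proved); BetaPertH ⇐ (D1) ∧ (D4) ∧
CAP+tail; G-an2-4 gates asym, D1 and NE2/3/4.  This file changes none of it. -/

open Finset MeasureTheory
open Literature.MathematicalPhysics.QuantumFieldTheory.Balaban1983to89
open Literature.MathematicalPhysics.QuantumFieldTheory.Balaban1983to89.Missing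
open Literature.MathematicalPhysics.QuantumFieldTheory.Balaban1983to89.T4Continuum
open Literature.MathematicalPhysics.QuantumFieldTheory.Balaban1983to89.T4FiniteEpsInhabited
open Literature.MathematicalPhysics.QuantumFieldTheory.Balaban1983to89.T4MatchingClosure
open Summit.QuantumFields.BalabanUV.T4Continuum
open HistoryChessboardTowerRepr HistoryChessboardGibbsSide HistoryChessboardGibbs
open HistoryChessboardEndWitness HistoryChessboardApexWitness
open HistoryRealiseCellsRunApexWitness HistoryRealiseCellsRunApexWitnessData

namespace Summit.QuantumFields.BalabanUV.T4Continuum.HistoryChessboardGibbsWitness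

noncomputable section

/-! ## §1 The one-term side with the datum's dressed integral as weight: every datum, run, string, cutoff -/

section Side

variable {F : T4Family} {G : Type} [GaugeGroup G] [MeasurableSpace G] [HaarData G] [RegularGaugeGroup G]

/-- **THE ONE-TERM SIDE ON THE DATA'S OWN GIBBS TOWER, `repr` A THEOREM.**  For every datum with measurable averagings,
every run `g₀`, every loop string `os`, cubes of any admissible side and every cutoff `K`: W7's eleven clauses hold for
ONE term whose event is the whole tower `Tower (F.P K) G K` and whose weight is the datum's dressed integral
`ZOf D g₀ os K t = ∫ e^{t·prodObs} ρ₀ dU`, NO pattern, empty bad class, rate `0` — `repr` is W-E1's E1 identity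
`integral_exp_mul_prodObs_dens_zero` on `Set.univ`; every located clause is vacuous BY DESIGN. [decided toy] -/
theorem gibbsCubeSide_univ (D : FiniteEpsData F G) (hM : D.AvgMeasurable) (g₀ : ℕ → ℝ) (os : List (ULoop F)) {m₁ : ℕ}
    (hm₁ : m₁ ≤ F.m) (K : ℕ) :
    GibbsCubeSide (ι := Unit) (Λ := Unit) D g₀ os hm₁ K ∅ {()} (fun t _ => ZOf D g₀ os K t) ∅ (fun _ => Set.univ)
      (fun _ _ => ∅) 0 where
  bad_subset := Finset.empty_subset _
  ev_meas := fun _ _ => MeasurableSet.univ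
  E_meas := fun _ h => (Finset.notMem_empty _ h).elim
  repr := fun t _ _ => by
    rw [setIntegral_univ]
    exact integral_exp_mul_prodObs_dens_zero D hM g₀ K os t
  ev_cover := fun ω _ => Set.mem_iUnion₂.2 ⟨(), Finset.mem_singleton_self _, Set.mem_univ ω⟩
  ev_disj := by simp
  bad_sub := fun _ h => (Finset.notMem_empty _ h).elim
  loc := fun _ h => (Finset.notMem_empty _ h).elim
  sym := fun _ h => (Finset.notMem_empty _ h).elim
  univ_le := fun _ h => (Finset.notMem_empty _ h).elim
  r_nonneg := le_rfl

/-- … read through W7's junction: the one-term side gives W4b′'s 21-clause `CutoffReading` of the run at cutoff `K` on its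
own Gibbs tower for (0.4)-block-averaged `SU(n)` data (`GibbsCubeSide.cutoffReading`, `prob` + RP five PRODUCED) — for
EVERY such datum, run and string. [decided toy] -/
example {n : ℕ} [NeZero n] (D : FiniteEpsData F (Matrix.specialUnitaryGroup (Fin n) ℂ))
    {ℰ : LoopAverage (Matrix.specialUnitaryGroup (Fin n) ℂ)} (hBA : D.IsBlockAveraged ℰ) (hE : ℰ.MeasurableE)
    (g₀ : ℕ → ℝ) (os : List (ULoop F)) {m₁ : ℕ} (hm₁ : m₁ ≤ F.m) (K : ℕ) :
    HistoryChessboardEventsCutoff.CutoffReading 4 (cubeCount F m₁) (∅ : Finset Unit) {()} (fun t _ => ZOf D g₀ os K t) ∅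
      (gibbsTower D g₀ K) (Zrun D K (g₀ K)) (fun _ => Set.univ) (obsTower K os) 1 (fun _ _ => ∅)
      (HistoryChessboardEventsCubes.cubeRefl (sitesPerDir_top_eq F hm₁ K))
      (HistoryChessboardEventsCubes.cubePos (Matrix.specialUnitaryGroup (Fin n) ℂ) (sitesPerDir_top_eq F hm₁ K)) 0 :=
  (gibbsCubeSide_univ D (hBA.avgMeasurable hE) g₀ os hm₁ K).cutoffReading hBA hE

end Side

/-! ## §2 The witness: one term per cutoff on the real towers, for any datum with measurable averagings -/

section Witness

variable {F : T4Family} {G : Type} [GaugeGroup G] [MeasurableSpace G] [HaarData G] [RegularGaugeGroup G]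

/-- **THE GIBBS-CUBE-TOWER WITNESS TERM** (module docstring §2) on ANY datum `D` with measurable averagings, for any run
`g₀` and any string `os` whose product observable is identically `1`: one term per cutoff (the whole tower) with the
dressed integrals `ZOf` as weights (sides = `gibbsCubeSide_univ` at `K` and `K+1`), NO pattern, cubes of side `L^0`, zero
shells, the NE7 budget with equality (`nuOf`), zero rates, `l₀ = vol = 1`, `K₀ = 0`. [decided toy] -/
def gibbsWitnessOf (D : FiniteEpsData F G) (hM : D.AvgMeasurable) {g₀ : ℕ → ℝ} {os : List (ULoop F)}
    (hobs : ∀ (K : ℕ) (U : GaugeField (F.P K) 0 G), T4GenFunBounds.prodObs (D.scheme g₀) K os U = 1) :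
    ChessboardGibbsWitness D g₀ os Unit Unit 0 where
  hm₁ := Nat.zero_le _
  l₀ := 1
  vol := 1
  l₀_pos := one_pos
  vol_pos := one_pos
  K₀ := 0
  P := ∅
  T := fun _ => {()}
  A := fun K t _ => ZOf D g₀ os K t
  A' := fun K t _ => ZOf D g₀ os (K + 1) t
  shA := fun _ _ _ => 0
  shB := fun _ _ _ => 0
  Bad := fun _ => ∅
  ev := fun _ _ => Set.univ
  E := fun _ _ _ => ∅
  r := fun _ => 0
  ev' := fun _ _ => Set.univ
  E' := fun _ _ _ => ∅
  r' := fun _ => 0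
  sideA := fun K _ => gibbsCubeSide_univ D hM g₀ os (Nat.zero_le _) K
  sideB := fun K _ => gibbsCubeSide_univ D hM g₀ os (Nat.zero_le _) (K + 1)
  sum_r := summable_zero
  sum_r' := summable_zero
  Cc := fun K _ _ => nuOf D g₀ os K
  Rr := fun _ _ _ => 0
  CcRec := fun _ _ _ => 0
  RrRec := fun _ _ _ => 0
  ν := nuOf D g₀ os
  u := fun _ => 0
  s₂ := fun _ => 0
  c₀ := fun _ => 0
  rr := fun _ => 0
  s := fun _ => 0
  Wsh := fun _ => 0
  shell := shellWeightBound_zero (fun K t _ => (ZOf_pos hobs K t).le) (fun K t _ => (ZOf_pos hobs (K + 1) t).le)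
  budget :=
    { nonneg := fun K t _ _ _ => by simpa only [sub_zero] using (ZOf_pos hobs K t).le
      lower := fun K t _ _ _ => by simpa only [sub_zero] using (exp_nuOf_mul hobs K t).le
      upper := fun K t _ _ _ => by simpa only [sub_zero, add_zero] using (exp_nuOf_mul hobs K t).ge
      uv_const := fun _ _ _ _ _ => by simp
      uv_radius := fun _ _ _ _ _ => by simp
      recent_remainder := fun _ _ _ _ _ => by simp
      recent_deviation := fun _ _ _ _ _ => by simp }
  sum_rr := summable_zero
  sum_u := summable_zero
  sum_s := summable_zero
  sum_s₂ := summable_zero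

/-- The toy keeps W6's toy's window, threshold and weights (definitionally): same `l₀ = vol = 1`, `K₀ = 0`, `A = ZOf`.
[decided toy] -/
example (D : FiniteEpsData F G) (hM : D.AvgMeasurable) {g₀ : ℕ → ℝ} {os : List (ULoop F)}
    (hobs : ∀ (K : ℕ) (U : GaugeField (F.P K) 0 G), T4GenFunBounds.prodObs (D.scheme g₀) K os U = 1) :
    (gibbsWitnessOf D hM hobs).l₀ = (witnessOf D hobs).l₀ ∧ (gibbsWitnessOf D hM hobs).vol = (witnessOf D hobs).vol ∧
      (gibbsWitnessOf D hM hobs).K₀ = (witnessOf D hobs).K₀ ∧ (gibbsWitnessOf D hM hobs).A = (witnessOf D hobs).A ∧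
      (gibbsWitnessOf D hM hobs).A' = (witnessOf D hobs).A' :=
  ⟨rfl, rfl, rfl, rfl, rfl⟩

/-- **THE SHAPE IS INHABITED on ANY datum with measurable averagings, for any run and any string with trivial product
observable.** [decided toy] -/
theorem nonempty_gibbsWitness_of_prodObs (D : FiniteEpsData F G) (hM : D.AvgMeasurable) {g₀ : ℕ → ℝ}
    {os : List (ULoop F)} (hobs : ∀ (K : ℕ) (U : GaugeField (F.P K) 0 G), T4GenFunBounds.prodObs (D.scheme g₀) K os U = 1) :
    Nonempty (ChessboardGibbsWitness D g₀ os Unit Unit 0) :=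
  ⟨gibbsWitnessOf D hM hobs⟩

/-- **… IN PARTICULAR FOR THE EMPTY STRING: ANY datum with measurable averagings, ANY regular gauge group, ANY run**
(S12h's `prodObs_nil`). [decided toy] -/
theorem nonempty_gibbsWitness_nil (D : FiniteEpsData F G) (hM : D.AvgMeasurable) (g₀ : ℕ → ℝ) :
    Nonempty (ChessboardGibbsWitness D g₀ ([] : List (ULoop F)) Unit Unit 0) :=
  nonempty_gibbsWitness_of_prodObs D hM fun K U => prodObs_nil G (D.scheme g₀) K U

variable (F G) in
/-- **ON THE TREE'S PLACEHOLDER `stubData` (measurable averagings) THE GIBBS-CUBE-TOWER WITNESS IS INHABITED** for the empty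
string and any run — like W6's (`nonempty_chessboardRoadWitness_stubData_nil`), unlike the count road's
(`isEmpty_countRoadWitness_stubData`): W7's shape has no (γ)-floor field either. [decided toy] -/
theorem nonempty_gibbsWitness_stubData_nil (av : (K j : ℕ) → Averaging (F.P K) j G)
    (hmeas : ∀ K j, Measurable (av K j).avg) (hac : ∀ K k, k < K → HaarAC (av K k).avg) (g₀ : ℕ → ℝ) :
    Nonempty (ChessboardGibbsWitness (stubData F G av hmeas hac) g₀ ([] : List (ULoop F)) Unit Unit 0) :=
  nonempty_gibbsWitness_nil (stubData F G av hmeas hac) (fun K j => hmeas K j) g₀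

variable (F G) in
/-- … side by side, decided: on `stubData` the Gibbs-cube-tower witness is INHABITED while the pin (B) FAILS
(`not_endStatementBPrinted_stub`) — so W7's (B)-antecedent headline `continuumYM4Torus_of_gibbsWitness_fsc` is not exercised
there, exactly as W6's and the count road's headlines are exercised by no toy. [decided toy] -/
example (av : (K j : ℕ) → Averaging (F.P K) j G) (hmeas : ∀ K j, Measurable (av K j).avg)
    (hac : ∀ K k, k < K → HaarAC (av K k).avg) (g₀ : ℕ → ℝ) :
    Nonempty (ChessboardGibbsWitness (stubData F G av hmeas hac) g₀ ([] : List (ULoop F)) Unit Unit 0) ∧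
      ¬ B16.EndStatementBPrinted (stubData F G av hmeas hac).C :=
  ⟨nonempty_gibbsWitness_stubData_nil F G av hmeas hac g₀, not_endStatementBPrinted_stub F G av⟩

end Witness

/-! ## §3 Over a subsingleton gauge group: every string; W7's headline binder verbatim -/

section Subsingleton

variable {F : T4Family} {G : Type} [GaugeGroup G] [MeasurableSpace G] [HaarData G] [RegularGaugeGroup G]
  [Subsingleton G]

/-- over a subsingleton gauge group the shape is inhabited for EVERY datum with measurable averagings, run and string
(`prodObs_eq_one`). [decided toy] -/
theorem nonempty_gibbsWitness (D : FiniteEpsData F G) (hM : D.AvgMeasurable) (g₀ : ℕ → ℝ) (os : List (ULoop F)) :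
    Nonempty (ChessboardGibbsWitness D g₀ os Unit Unit 0) :=
  nonempty_gibbsWitness_of_prodObs D hM fun K U => prodObs_eq_one D g₀ K os U

/-- **W7's HEADLINE BINDER `hData` HOLDS, VERBATIM, for EVERY datum with measurable averagings over a subsingleton gauge
group** (`ForSmallCouplings.of_forall`: thresholds `γ₀ = g₁ = 1`; the tuning clause is not even used). [decided toy] -/
theorem forSmallCouplings_gibbsWitness (D : FiniteEpsData F G) (hM : D.AvgMeasurable) :
    T4ContinuumYM4Torus.ForSmallCouplings D fun g₀ => ∀ os : List (ULoop F),
      ∃ (ι Λ : Type) (_ : DecidableEq ι) (m₁ : ℕ), Nonempty (ChessboardGibbsWitness D g₀ os ι Λ m₁) :=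
  T4ContinuumYM4Torus.ForSmallCouplings.of_forall fun g₀ os =>
    ⟨Unit, Unit, inferInstance, 0, nonempty_gibbsWitness D hM g₀ os⟩

end Subsingleton

/-! ## §4 W7's ENDs fire on the toy: the empty string at `SU(n)`; every string at `SU(1)` (plumbing tests) -/

section SUn

variable {F : T4Family} {n : ℕ} [NeZero n] {ℰ : LoopAverage (Matrix.specialUnitaryGroup (Fin n) ℂ)}

/-- **W7's PER-WITNESS END FIRES FOR THE EMPTY STRING AT EVERY `SU(n)`**: for every (0.4)-block-averaged `SU(n)` datum
with a measurable small-loop average and every run, the apex lineage's per-string hybrid-NE7 datum of the EMPTY string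
holds from some cutoff on, with window `l₀ = vol = 1` (`stringHybridNE7_of_gibbsWitness` APPLIED to `gibbsWitnessOf`;
the empty product observable is `1` — physically empty, a plumbing test). [decided toy] -/
theorem stringHybridNE7_nil_fires (D : FiniteEpsData F (Matrix.specialUnitaryGroup (Fin n) ℂ))
    (hBA : D.IsBlockAveraged ℰ) (hE : ℰ.MeasurableE) (g₀ : ℕ → ℝ) :
    ∃ K, 0 ≤ K ∧ T4MatchingAssembly.StringHybridNE7 (D.scheme g₀) ([] : List (ULoop F)) 1 1 K :=
  stringHybridNE7_of_gibbsWitness hBA hE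
    (gibbsWitnessOf D (hBA.avgMeasurable hE) fun K U => prodObs_nil _ (D.scheme g₀) K U)

end SUn

section SU1

variable {F : T4Family}

/-- at `SU(1)`, for EVERY finite-ε datum with measurable averagings: W7's headline binder `hData`. [decided toy] -/
theorem forSmallCouplings_gibbsWitness_SU1 (D : FiniteEpsData F (Matrix.specialUnitaryGroup (Fin 1) ℂ))
    (hM : D.AvgMeasurable) :
    T4ContinuumYM4Torus.ForSmallCouplings D fun g₀ => ∀ os : List (ULoop F),
      ∃ (ι Λ : Type) (_ : DecidableEq ι) (m₁ : ℕ), Nonempty (ChessboardGibbsWitness D g₀ os ι Λ m₁) :=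
  haveI := subsingleton_SU1
  forSmallCouplings_gibbsWitness D hM

variable {ℰ : LoopAverage (Matrix.specialUnitaryGroup (Fin 1) ℂ)}

/-- **W7's PIN-FREE STRINGWISE END FIRES** (`forSmallCouplings_stringwise_of_gibbsWitness` APPLIED): every
(0.4)-block-averaged `SU(1)` datum with a measurable small-loop average carries, for all small couplings (thresholds `1, 1`),
the per-string hybrid-NE7 datum of every loop string — over the trivial group a plumbing test of road W on the Gibbs cube
towers (as a FACT it is p226019's `forSmallCouplings_stringwise`, which needs neither `hBA` nor `hE`; kept an `example`).
[decided toy] -/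
example (D : FiniteEpsData F (Matrix.specialUnitaryGroup (Fin 1) ℂ)) (hBA : D.IsBlockAveraged ℰ) (hE : ℰ.MeasurableE) :
    T4ContinuumYM4Torus.ForSmallCouplings D fun g₀ => T4ApexHybrid.StringwiseHybridNE7 (D.scheme g₀) :=
  forSmallCouplings_stringwise_of_gibbsWitness D hBA hE (forSmallCouplings_gibbsWitness_SU1 D (hBA.avgMeasurable hE))

/-- **W7's APEX INPUT FIRES at `SU(1)`**: `HybridNE7Under D (BetaPertHyp D.βfun)` through `hybridNE7Under_of_gibbsWitness_fsc`
(as a FACT it is p226019's `hybridNE7Under_SU1`; kept an `example` — the plumbing of W7 file 2 exercised). [decided toy] -/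
example (D : FiniteEpsData F (Matrix.specialUnitaryGroup (Fin 1) ℂ)) (hBA : D.IsBlockAveraged ℰ) (hE : ℰ.MeasurableE) :
    T4ApexHybrid.HybridNE7Under D (BetaPertHyp D.βfun) :=
  hybridNE7Under_of_gibbsWitness_fsc D hBA hE (forSmallCouplings_gibbsWitness_SU1 D (hBA.avgMeasurable hE))

/-- **THE FOUR PREFIXED T⁴ TARGETS FIRE at `SU(1)`** (`targets_of_gibbsWitness_fsc` APPLIED; no pin is an input): for every
(0.4)-block-averaged `SU(1)` datum with a measurable small-loop average.  Over the TRIVIAL group every Wilson loop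
expectation is `1` at every cutoff, so this is a test of the road's PLUMBING end to end, physically empty; it says nothing
about `SU(n)`, `n ≥ 2`, where the displayed witness IS the content of NE7b's road W. [decided toy] -/
theorem targets_fire_SU1 (D : FiniteEpsData F (Matrix.specialUnitaryGroup (Fin 1) ℂ)) (hBA : D.IsBlockAveraged ℰ)
    (hE : ℰ.MeasurableE) :
    D.ym4_torus_continuum_limit_exists ∧ D.ym4_torus_continuum_limit_unique ∧ D.limit_reflectionPositive ∧
      D.limit_torusCovariant :=
  targets_of_gibbsWitness_fsc D hBA hE (forSmallCouplings_gibbsWitness_SU1 D (hBA.avgMeasurable hE))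

end SU1

end

end Summit.QuantumFields.BalabanUV.T4Continuum.HistoryChessboardGibbsWitness
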